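import Mathlib
import Summits.ValiantsHypothesis.ValiantsHypothesis.Theorems.LacunarySymmetroidMatrixDescartesCensusRealExponentsDoors

/-!
# `MatrixDescartes` census — the real-exponent residue of the doors: density reduction, affine invariance, Sidon confinement

HONEST FRAMING.  Object-search cell `pub-symmetroid`, items `DoorA26 = PosRootLawAt 2 6 19`
(stmt-ValiantsHypothesis-19979) and `DoorA34 = PosRootLawAt 3 4 18` (stmt-ValiantsHypothesis-19980),
OPEN, typed, never asserted; structure theorems about their real-exponent residue
(`…CensusRealExponentsDoors`), deciding neither.  Nothing here bears on `MatrixDescartes`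
(stmt-ValiantsHypothesis-18050) or `VP ≠ VNP`.

Write `L(m,K,B) = {δ ∈ ℝ^K : ∃ S symmetric, #{x > 0 : det ∑_l x^{δ_l} S_l = 0} ≥ B + 1}` (the residue;
OPEN for sharp `B` by `isOpen_setOf_realRow`).

* `posRootLawAt_of_dense` — **a DENSE set of exponent vectors suffices**: for a sharp bound, if the
  real row holds at every `δ` of some dense `D ⊆ ℝ^K`, it holds everywhere, hence `PosRootLawAt m K B`
  (an open set missing a dense set is empty).  So any proof of `DoorA26` may assume the exponents in
  general position (e.g. `ℚ`-linearly independent, or rational, or algebraic — any dense class);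
  `doorA26_of_dense`, `doorA34_of_dense`;
* `mem_locus_affine_iff` — `L` is invariant under `δ ↦ a + c·δ`, `c ≠ 0` (scaling `x ↦ x^{1/c}`,
  the mirror `c < 0`, and the shift, which multiplies `det` by a power of `x`);
* `realRow_of_sum_coincidence` — **Sidon confinement**: if two distinct sorted index words
  `λ₁ ≠ λ₂ : Fin m → Fin K` have the same exponent sum `∑_i δ_{λ₁ i} = ∑_i δ_{λ₂ i}` (at `m = 2`: a
  repeated PAIR SUM), the determinant has at most `#{monotone λ} − 1` distinct exponentials, hence
  `≤ #{monotone λ} − 2` zeros for EVERY `S`: such `δ` are never in the residue.  For `(2,6)`: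
  `realRow_two_six_of_pairSum_eq` — a real exponent vector with a repeated pair sum carries no twenty
  (the real-exponent form of the cell's «repeated pair sum ⇒ Descartes» integer lemma), i.e.
  `L(2,6,19)` lies in the open cone of 2-Sidon exponent vectors.

[folklore] Point-set topology (`Dense.inter_open_nonempty`); Laguerre's count (tree Literature
`Braess1986_VI_1_1_proper_holds` via the kit).
-/

-- `Summit.ValiantsHypothesis.ValiantsHypothesis.…` repeats a component by the D-0017 layout
-- (single-conjunct summit), which the `dupNamespace` linter flags; the name is mandated.
set_option linter.dupNamespace false

namespace Summit.ValiantsHypothesis.ValiantsHypothesis.Theorems.LacunarySymmetroidMatrixDescartes.Census.RealExp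

open Finset
open scoped BigOperators Matrix
open Summit.ValiantsHypothesis.ValiantsHypothesis.Theorems.MatrixDescartes.Negative (PosRootLawAt)

section Density

variable {m K : ℕ}

/-- **A dense set of exponent vectors suffices.**  For a sharp bound, if the real-exponent row holds
at every exponent vector of a DENSE subset `D ⊆ ℝ^K`, then `PosRootLawAt m K B` (all integer supports —
and, by `posRootLawAt_iff_rpow`, all real exponent vectors).  Proof: the residue is open
(`isOpen_setOf_realRow`) and misses `D`. [folklore] -/
theorem posRootLawAt_of_dense {B : ℕ}
    (hB : (univ.filter (fun lam : Fin m → Fin K => Monotone lam)).card ≤ B + 2)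
    {D : Set (Fin K → ℝ)} (hD : Dense D)
    (h : ∀ δ ∈ D, ∀ (S : Fin K → Matrix (Fin m) (Fin m) ℝ), (∀ l, (S l).IsSymm) →
      {x : ℝ | 0 < x ∧ (∑ l, (x ^ (δ l)) • S l).det = 0}.ncard ≤ B) :
    PosRootLawAt m K B := by
  rw [posRootLawAt_iff_rpow hB]
  intro δ S hS
  by_contra hcon
  push Not at hcon
  set L : Set (Fin K → ℝ) := {δ' : Fin K → ℝ | ∃ S' : Fin K → Matrix (Fin m) (Fin m) ℝ,
    (∀ l, (S' l).IsSymm) ∧ B + 1 ≤ {x : ℝ | 0 < x ∧ (∑ l, (x ^ (δ' l)) • S' l).det = 0}.ncard} with hL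
  have hopen : IsOpen L := isOpen_setOf_realRow hB
  have hmem : δ ∈ L := ⟨S, hS, by omega⟩
  obtain ⟨δ', hδ'L, hδ'D⟩ := hD.inter_open_nonempty L hopen ⟨δ, hmem⟩
  obtain ⟨S', hS', hcount⟩ := hδ'L
  have := h δ' hδ'D S' hS'
  omega

/-- `DoorA26` from a dense set of real exponent vectors. [folklore] -/
theorem doorA26_of_dense {D : Set (Fin 6 → ℝ)} (hD : Dense D)
    (h : ∀ δ ∈ D, ∀ (S : Fin 6 → Matrix (Fin 2) (Fin 2) ℝ), (∀ l, (S l).IsSymm) →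
      {x : ℝ | 0 < x ∧ (∑ l, (x ^ (δ l)) • S l).det = 0}.ncard ≤ 19) : DoorA26 :=
  posRootLawAt_of_dense (m := 2) (K := 6) (B := 19) (by rw [card_monotone_two_six]) hD h

/-- `DoorA34` from a dense set of real exponent vectors. [folklore] -/
theorem doorA34_of_dense {D : Set (Fin 4 → ℝ)} (hD : Dense D)
    (h : ∀ δ ∈ D, ∀ (S : Fin 4 → Matrix (Fin 3) (Fin 3) ℝ), (∀ l, (S l).IsSymm) →
      {x : ℝ | 0 < x ∧ (∑ l, (x ^ (δ l)) • S l).det = 0}.ncard ≤ 18) : DoorA34 :=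
  posRootLawAt_of_dense (m := 3) (K := 4) (B := 18) (by rw [card_monotone_three_four]) hD h

end Density

section Affine

variable {m K : ℕ}

/-- **Affine invariance of the zero count (real powers).**  For `c ≠ 0` and any `a`, the pencils with
exponent vectors `δ` and `l ↦ a + c·δ_l` have the same number of positive zeros, for the same letters
`S` (substitution `x ↦ x^{1/c}` and a monomial factor). [folklore] -/
theorem ncard_rpow_affine (δ : Fin K → ℝ) (S : Fin K → Matrix (Fin m) (Fin m) ℝ) (a : ℝ) {c : ℝ}
    (hc : c ≠ 0) :
    {x : ℝ | 0 < x ∧ (∑ l, (x ^ (a + c * δ l)) • S l).det = 0}.ncard =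
      {x : ℝ | 0 < x ∧ (∑ l, (x ^ (δ l)) • S l).det = 0}.ncard := by
  classical
  rw [ncard_rpow_eq_ncard_exp (fun l => a + c * δ l) S, ncard_rpow_eq_ncard_exp δ S]
  have hfac : ∀ t, (∑ l, Real.exp ((a + c * δ l) * t) • S l) =
      Real.exp (a * t) • ∑ l, Real.exp (δ l * (c * t)) • S l := by
    intro t
    rw [Finset.smul_sum]
    refine Finset.sum_congr rfl fun l _ => ?_
    rw [smul_smul, ← Real.exp_add]
    congr 1; congr 1; ring
  have hzero : ∀ t, (∑ l, Real.exp ((a + c * δ l) * t) • S l).det = 0 ↔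
      (∑ l, Real.exp (δ l * (c * t)) • S l).det = 0 := by
    intro t
    rw [hfac t, Matrix.det_smul, Fintype.card_fin]
    constructor
    · intro h
      rcases mul_eq_zero.mp h with h | h
      · exact absurd h (pow_ne_zero _ (Real.exp_pos _).ne')
      · exact h
    · intro h; rw [h, mul_zero]
  have himage : (fun t => c * t) '' {t : ℝ | (∑ l, Real.exp ((a + c * δ l) * t) • S l).det = 0} =
      {t : ℝ | (∑ l, Real.exp (δ l * t) • S l).det = 0} := by
    ext u
    constructor
    · rintro ⟨t, ht, rfl⟩
      exact (hzero t).mp ht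
    · intro hu
      refine ⟨u / c, ?_, by field_simp⟩
      rw [Set.mem_setOf_eq, hzero, mul_div_cancel₀ _ hc]
      exact hu
  rw [← himage, Set.ncard_image_of_injective _ (mul_right_injective₀ hc)]

/-- **The residue is affinely invariant.**  `δ` carries a pencil with `≥ B + 1` positive zeros iff
`a + c·δ` does (`c ≠ 0`); in particular the residue is a union of lines through its points in the
direction `(1,…,1)`, invariant under positive scaling and under the mirror `δ ↦ −δ`. [folklore] -/
theorem mem_locus_affine_iff {B : ℕ} (δ : Fin K → ℝ) (a : ℝ) {c : ℝ} (hc : c ≠ 0) :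
    (∃ S : Fin K → Matrix (Fin m) (Fin m) ℝ, (∀ l, (S l).IsSymm) ∧
        B + 1 ≤ {x : ℝ | 0 < x ∧ (∑ l, (x ^ (a + c * δ l)) • S l).det = 0}.ncard) ↔
      ∃ S : Fin K → Matrix (Fin m) (Fin m) ℝ, (∀ l, (S l).IsSymm) ∧
        B + 1 ≤ {x : ℝ | 0 < x ∧ (∑ l, (x ^ (δ l)) • S l).det = 0}.ncard := by
  constructor
  · rintro ⟨S, hS, h⟩
    exact ⟨S, hS, by rwa [ncard_rpow_affine δ S a hc] at h⟩
  · rintro ⟨S, hS, h⟩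
    exact ⟨S, hS, by rwa [ncard_rpow_affine δ S a hc]⟩

end Affine

section Sidon

variable {m K : ℕ}

/-- **Sidon confinement.**  If two distinct MONOTONE index words `λ₁ ≠ λ₂` have equal exponent sums
`∑_i δ_{λ₁ i} = ∑_i δ_{λ₂ i}`, then for every choice of letters `S` the real-exponent pencil
`∑_l x^{δ_l} S_l` has at most `#{monotone λ} − 2` zeros on `(0,∞)` (or its determinant vanishes
identically): the determinant is an exponential sum with at most `#{monotone λ} − 1` distinct
exponents (Laguerre).  So exponent vectors with a coincidence of `m`-fold sums never lie in the
residue of a sharp row. [folklore] -/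
theorem realRow_of_sum_coincidence (δ : Fin K → ℝ) {lam₁ lam₂ : Fin m → Fin K}
    (h₁ : Monotone lam₁) (h₂ : Monotone lam₂) (hne : lam₁ ≠ lam₂)
    (hsum : ∑ i, δ (lam₁ i) = ∑ i, δ (lam₂ i))
    (S : Fin K → Matrix (Fin m) (Fin m) ℝ) :
    {x : ℝ | 0 < x ∧ (∑ l, (x ^ (δ l)) • S l).det = 0}.ncard ≤
      (univ.filter (fun lam : Fin m → Fin K => Monotone lam)).card - 2 := by
  classical
  rw [ncard_rpow_eq_ncard_exp δ S]
  set α : Equiv.Perm (Fin m) × (Fin m → Fin K) → ℝ :=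
    fun p => ((Equiv.Perm.sign p.1 : ℤ) : ℝ) * ∏ i, S (p.2 i) (p.1 i) i with hα
  set s : Equiv.Perm (Fin m) × (Fin m → Fin K) → ℝ := fun p => ∑ i, δ (p.2 i) with hs
  have hGsum : ∀ t, (∑ l, Real.exp (δ l * t) • S l).det = ∑ p, α p * Real.exp (s p * t) :=
    fun t => det_expPencil_eq_expSum δ S t
  have hset : {t : ℝ | (∑ l, Real.exp (δ l * t) • S l).det = 0} =
      {t | ∑ p, α p * Real.exp (s p * t) = 0} := by
    ext t; rw [Set.mem_setOf_eq, Set.mem_setOf_eq, hGsum]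
  rw [hset]
  -- distinct exponents: at most `#monotone − 1`
  set Mono : Finset (Fin m → Fin K) := univ.filter (fun lam : Fin m → Fin K => Monotone lam) with hMono
  have hsub : univ.image s ⊆ (Mono.erase lam₂).image (fun lam => ∑ i, δ (lam i)) := by
    intro y hy
    rw [Finset.mem_image] at hy ⊢
    obtain ⟨p, -, rfl⟩ := hy
    -- sort `p.2`
    set μ : Fin m → Fin K := p.2 ∘ (Tuple.sort p.2) with hμ
    have hμmono : Monotone μ := Tuple.monotone_sort p.2
    have hμsum : ∑ i, δ (μ i) = s p := Equiv.sum_comp (Tuple.sort p.2) (fun i => δ (p.2 i))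
    by_cases hμ2 : μ = lam₂
    · refine ⟨lam₁, ?_, ?_⟩
      · rw [Finset.mem_erase, hMono, Finset.mem_filter]
        exact ⟨hne, mem_univ _, h₁⟩
      · rw [hsum, ← hμ2, hμsum]
    · refine ⟨μ, ?_, hμsum⟩
      rw [Finset.mem_erase, hMono, Finset.mem_filter]
      exact ⟨hμ2, mem_univ _, hμmono⟩
  have hmem₂ : lam₂ ∈ Mono := by rw [hMono, Finset.mem_filter]; exact ⟨mem_univ _, h₂⟩
  have hcard : (univ.image s).card ≤ Mono.card - 1 := by
    refine (Finset.card_le_card hsub).trans (Finset.card_image_le.trans ?_)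
    rw [Finset.card_erase_of_mem hmem₂]
  rcases expSum_zero_or_ncard_le α s with h0 | ⟨-, hle⟩
  · have : {t | ∑ p, α p * Real.exp (s p * t) = 0} = Set.univ := Set.eq_univ_iff_forall.mpr h0
    rw [this, Set.infinite_univ.ncard]
    exact Nat.zero_le _
  · omega

/-- **`(2,6)`: a repeated pair sum kills every twenty (real exponents).**  If `δ_i + δ_j = δ_k + δ_l`
for two different sorted pairs `i ≤ j`, `k ≤ l`, then every six-letter real symmetric `2 × 2` pencil
on `δ` has `≤ 19` zeros on `(0,∞)`; equivalently the residue `L(2,6,19)` lies in the open cone of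
2-Sidon exponent vectors.  (The integer version is the cell's «repeated pair sum ⇒ Descartes» lemma.)
[folklore] -/
theorem realRow_two_six_of_pairSum_eq (δ : Fin 6 → ℝ) {i j k l : Fin 6} (hij : i ≤ j) (hkl : k ≤ l)
    (hne : (i, j) ≠ (k, l)) (hsum : δ i + δ j = δ k + δ l)
    (S : Fin 6 → Matrix (Fin 2) (Fin 2) ℝ) :
    {x : ℝ | 0 < x ∧ (∑ l, (x ^ (δ l)) • S l).det = 0}.ncard ≤ 19 := by
  have hm₁ : Monotone (![i, j] : Fin 2 → Fin 6) := by
    refine Fin.monotone_iff_le_succ.mpr fun a => ?_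
    fin_cases a; simpa using hij
  have hm₂ : Monotone (![k, l] : Fin 2 → Fin 6) := by
    refine Fin.monotone_iff_le_succ.mpr fun a => ?_
    fin_cases a; simpa using hkl
  have hne' : (![i, j] : Fin 2 → Fin 6) ≠ ![k, l] := by
    intro h
    apply hne
    have h0 := congrFun h 0
    have h1 := congrFun h 1
    simp only [Matrix.cons_val_zero, Matrix.cons_val_one] at h0 h1
    rw [h0, h1]
  have hsum' : ∑ a, δ ((![i, j] : Fin 2 → Fin 6) a) = ∑ a, δ ((![k, l] : Fin 2 → Fin 6) a) := by
    simp only [Fin.sum_univ_two, Matrix.cons_val_zero, Matrix.cons_val_one]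
    exact hsum
  have h := realRow_of_sum_coincidence δ hm₁ hm₂ hne' hsum' S
  rw [card_monotone_two_six] at h
  exact h

end Sidon

end Summit.ValiantsHypothesis.ValiantsHypothesis.Theorems.LacunarySymmetroidMatrixDescartes.Census.RealExp
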